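import Summits.HubbardSuperconductivity.HubbardSuperconductivity.Theorems.BalabanIRBirComplexStableXYRStubThinFormCoercive
import Summits.HubbardSuperconductivity.HubbardSuperconductivity.Theorems.BalabanIRBirComplexStableXYRStubWindingSectorCost
import Literature.MathematicalPhysics.QuantumFieldTheory.TorusChartFlatCochains
import HarnessLib

/-!
# Route `BalabanIR`, crux `BirComplexStableXYR` (item `stmt-HubbardSuperconductivity-14845`),
# line `fat-gaussian-defect-calculus`: stub E3 `stub_holonomyStrainConst`

Helper (`--supports`) for the crux
`Summit.HubbardSuperconductivity.HubbardSuperconductivity.Theses.BalabanIR.BirComplexStableXYR`,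
line `fat-gaussian-defect-calculus` (lead skeleton `Cruxes/BirComplexStableXYR/Lines/fat_gaussian_defect_calculus.lean`,
lead c8, wave 8), stub E3 `stub_holonomyStrainConst`: **the Coulomb strain of a vortex-free sector IS the constant
twist.**

**Statement.** On the space–time torus `Λ L M = (Fin 2 → ZMod L) × ZMod M` (chart `F = TorusChart.piProdZMod 2 L M`,
directions `0, 1` of period `L`, direction `2` of period `M`), for a window Fourier table `c : Table r` (`r ≥ 2`) with
(N) `Σ_n c_n = 0` and the coercivity (C), let `𝒬(ω) = Σ_s Q(P ω s)` be the thin Gaussian form (window Hessian form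
`Q` of the window path configurations `P ω s`, both given through their defining equations `hQ`, `hP`), and assume
Pythagoras for CONSTANT cochains, `𝒬(d₀u − v) = 𝒬(d₀u) + 𝒬(v)` (hypothesis; it is stub E1
`stub_constCochainPythagoras`).  If `a` is a vortex-free integer `1`-cochain (`d₁ a = 0`) with windings `wind a = h`
and `σ = 2πa − d₀ψ` is a strain of its class with the Pythagoras property `𝒬(d₀u − σ) = 𝒬(d₀u) + 𝒬(σ)` for all
`u`, then `σ` is the constant cochain `σ̄_h : (x, i) ↦ 2π h_i / N_i`.

**Proof.** (1) Over `ℝ`, `2πa − σ̄_h` is flat with zero winding vector, hence a gradient `d₀ g` (landed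
`windingSector_exists_d₀`, from `TorusChart.exists_d₀_eq_iff`); so `σ = σ̄_h + d₀ w` with `w = g − ψ`.
(2) The thin form is even, `𝒬(−ω) = 𝒬(ω)` (`P` is odd in the cochain, `Q` is even).  Pythagoras for `σ` at `u = w`
(`d₀w − σ = −σ̄_h`) gives `𝒬(σ̄_h) = 𝒬(d₀w) + 𝒬(σ)`; Pythagoras for the constant `σ̄_h` at `u = −w`
(`d₀(−w) − σ̄_h = −σ`) gives `𝒬(σ) = 𝒬(d₀w) + 𝒬(σ̄_h)`; adding, `𝒬(d₀w) = 0`.  (3) Coercivity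
(landed `stub_thinFormCoercive`): `2c₀ Σ_{x,i} (d₀w)(x,i)² ≤ 𝒬(d₀w) = 0` with `c₀ > 0` forces `d₀ w = 0`, whence
`σ = σ̄_h`.  Elementary; no definition and no named fact is introduced; sorry-free. [folklore]
-/

set_option linter.dupNamespace false -- `Summit.<S>.<S>.Theorems…` repeats the summit name (D-0017 layout)

namespace Summit.HubbardSuperconductivity.HubbardSuperconductivity.Theorems.FSUnfolding

open scoped BigOperators
open Literature.MathematicalPhysics.QuantumFieldTheory Literature.Probability.LatticeModels
open Summit.HubbardSuperconductivity.BirComplexStableXYNegative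

/-- **A sum of squares over a double finite index that is `≤ 0` has all its terms zero.** [folklore] -/
theorem hsc_eq_zero_of_sum_sum_sq_nonpos {α β : Type*} [Fintype α] [Fintype β] (f : α → β → ℝ)
    (h : ∑ x, ∑ i, (f x i) ^ 2 ≤ 0) : ∀ x i, f x i = 0 := by
  intro x i
  have hnn : ∀ y, 0 ≤ ∑ j, (f y j) ^ 2 := fun y => Finset.sum_nonneg fun j _ => sq_nonneg _
  have hss : ∑ y, ∑ j, (f y j) ^ 2 = 0 := le_antisymm h (Finset.sum_nonneg fun y _ => hnn y)
  have hx := (Finset.sum_eq_zero_iff_of_nonneg fun y _ => hnn y).1 hss x (Finset.mem_univ x)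
  have hi := (Finset.sum_eq_zero_iff_of_nonneg fun j _ => sq_nonneg (f x j)).1 hx i (Finset.mem_univ i)
  exact (pow_eq_zero_iff two_ne_zero).1 hi

/-- **Stub E3 `stub_holonomyStrainConst` (registered signature, verbatim): the Coulomb strain of a vortex-free sector
is the constant twist.**  Under (N), (C), `r ≥ 2` and given Pythagoras for constant cochains (hypothesis), for an
integer `1`-cochain `a` with `d₁a = 0` and windings `h`, ANY strain `σ = 2πa − d₀ψ` with the Pythagoras property of
`stub_fsRepresentation` equals `σ̄_h = (2πh_i/N_i)_i`: `2πa − σ̄_h = d₀g` over `ℝ` (`windingSector_exists_d₀`), so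
`σ = σ̄_h + d₀w`; the two Pythagoras identities and the evenness of the thin form give `𝒬(d₀w) = 0`, and the
coercivity `stub_thinFormCoercive` (`𝒬 ≥ 2c₀‖·‖²`) forces `d₀w = 0`.  Consequently the vortex-free sector weights of
the Fröhlich–Spencer representation are EXACTLY `exp(−(K/2)|Λ|·Q(v̄_h))`. [folklore] -/
theorem stub_holonomyStrainConst :
    ∀ (r : ℕ) (c : Table r) (c₀ : ℝ), 2 ≤ r → 0 < c₀ → c.sum (fun _ a => a) = 0 →
      (∀ φ : W r → ℝ, c₀ * ∑ w, ∑ w', (1 - Real.cos (φ w - φ w')) ≤ (genF c φ).re) →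
      ∀ (L M : ℕ) [NeZero L] [NeZero M]
      (P : (Λ L M → Fin 3 → ℝ) → Λ L M → W r → ℝ),
      (∀ (ω : Λ L M → Fin 3 → ℝ) (s : Λ L M) (w : W r), P ω s w =
        (TorusChart.piProdZMod 2 L M).lineSum ω 0 (w.1 : ℕ) s
          + (TorusChart.piProdZMod 2 L M).lineSum ω 1 (w.2.1 : ℕ) (s + (w.1 : ℕ) • (TorusChart.piProdZMod 2 L M).gen 0)
          + (TorusChart.piProdZMod 2 L M).lineSum ω 2 (w.2.2 : ℕ)
            (s + (w.1 : ℕ) • (TorusChart.piProdZMod 2 L M).gen 0 + (w.2.1 : ℕ) • (TorusChart.piProdZMod 2 L M).gen 1)) →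
      ∀ (Q : (W r → ℝ) → ℝ),
      (∀ u : W r → ℝ, Q u = (-c.sum (fun n a => a * (((∑ w, (n w : ℝ) * u w) ^ 2 : ℝ) : ℂ))).re) →
      (∀ (v : Fin 3 → ℝ) (u : Λ L M → ℝ),
        ∑ s : Λ L M, Q (P (fun x i => (TorusChart.piProdZMod 2 L M).d₀ u x i - v i) s) =
          ∑ s : Λ L M, Q (P ((TorusChart.piProdZMod 2 L M).d₀ u) s) + ∑ s : Λ L M, Q (P (fun _ i => v i) s)) →
      ∀ (h : Fin 3 → ℤ) (a : Λ L M → Fin 3 → ℤ), (TorusChart.piProdZMod 2 L M).d₁ a = 0 →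
        (TorusChart.piProdZMod 2 L M).wind a = h →
      ∀ (σ : Λ L M → Fin 3 → ℝ),
        (∃ ψ : Λ L M → ℝ, σ = fun x i => 2 * Real.pi * (a x i : ℝ) - (TorusChart.piProdZMod 2 L M).d₀ ψ x i) →
        (∀ u : Λ L M → ℝ,
          ∑ s : Λ L M, Q (P (fun x i => (TorusChart.piProdZMod 2 L M).d₀ u x i - σ x i) s) =
            ∑ s : Λ L M, Q (P ((TorusChart.piProdZMod 2 L M).d₀ u) s) + ∑ s : Λ L M, Q (P σ s)) →
        σ = fun _ i => 2 * Real.pi * (h i : ℝ) / ((TorusChart.piProdZMod 2 L M).period i : ℝ) := by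
  intro r c c₀ hr hc₀ hN hC L M _ _ P hP Q hQ hconst h a hd₁ hwind σ hσ hpyth
  obtain ⟨ψ, hσ⟩ := hσ
  set F := TorusChart.piProdZMod 2 L M
  -- (0) coercivity of the thin form on every real `1`-cochain (P1e), in the `Q ∘ P` form
  have hcoer : ∀ ω : Λ L M → Fin 3 → ℝ, 2 * c₀ * ∑ x : Λ L M, ∑ i : Fin 3, (ω x i) ^ 2 ≤ ∑ s, Q (P ω s) := by
    intro ω
    have h1 := stub_thinFormCoercive r c c₀ hr hc₀ hN hC L M ω
    simp only [hQ, hP]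
    exact h1
  -- (0') the thin form is even: `P` is odd in the cochain and `Q` is even
  have hQeven : ∀ u : W r → ℝ, Q (fun w => -u w) = Q u := by
    intro u
    simp only [hQ, mul_neg, Finset.sum_neg_distrib, neg_sq]
  have hPneg : ∀ (ω : Λ L M → Fin 3 → ℝ) (s : Λ L M), P (-ω) s = fun w => -P ω s w := by
    intro ω s
    funext w
    rw [hP, hP]
    simp only [TorusChart.lineSum, Pi.neg_apply, Finset.sum_neg_distrib]
    ring
  have hneg : ∀ ω : Λ L M → Fin 3 → ℝ, ∑ s : Λ L M, Q (P (-ω) s) = ∑ s : Λ L M, Q (P ω s) := by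
    intro ω
    refine Finset.sum_congr rfl fun s _ => ?_
    rw [hPneg]
    exact hQeven (P ω s)
  -- the constant twist `σb i = 2π h i / N_i` (kept opaque through `hσb`)
  obtain ⟨σb, hσb⟩ : ∃ σb : Fin 3 → ℝ, ∀ i, σb i = 2 * Real.pi * (h i : ℝ) / (F.period i : ℝ) :=
    ⟨_, fun _ => rfl⟩
  -- (1) `2πa = σb + d₀ g` over `ℝ`, hence `σ = σb + d₀ (g - ψ)`
  obtain ⟨g, hg⟩ := windingSector_exists_d₀ F (2 * Real.pi) a hd₁
  rw [hwind] at hg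
  have hσ' : ∀ (x : Λ L M) (i : Fin 3), σ x i = σb i + F.d₀ (fun y => g y - ψ y) x i := by
    intro x i
    have hgx := congrFun (congrFun hg x) i
    rw [hσ, hσb]
    simp only [TorusChart.d₀_apply] at hgx ⊢
    linarith
  -- (2a) Pythagoras for `σ` at `u = g - ψ`: `d₀u - σ = -σb`
  have hkey1 : (fun x i => F.d₀ (fun y => g y - ψ y) x i - σ x i) = -(fun (_ : Λ L M) (i : Fin 3) => σb i) := by
    funext x i
    simp only [Pi.neg_apply]
    rw [hσ' x i]
    ring
  have h1 := hpyth (fun y => g y - ψ y)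
  rw [hkey1, hneg] at h1
  -- (2b) Pythagoras for the constant `σb` at `u = ψ - g`: `d₀u - σb = -σ`
  have hkey2 : (fun x i => F.d₀ (fun y => ψ y - g y) x i - σb i) = -σ := by
    funext x i
    simp only [Pi.neg_apply]
    rw [hσ' x i]
    simp only [TorusChart.d₀_apply]
    ring
  have hkey3 : F.d₀ (fun y => ψ y - g y) = -F.d₀ (fun y => g y - ψ y) := by
    funext x i
    simp only [TorusChart.d₀_apply, Pi.neg_apply]
    ring
  have h2 := hconst σb (fun y => ψ y - g y)
  rw [hkey2, hkey3, hneg, hneg] at h2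
  -- (2c) adding the two identities: the gradient part has zero thin-form energy
  have hQ0 : ∑ s : Λ L M, Q (P (F.d₀ (fun y => g y - ψ y)) s) = 0 := by linarith
  -- (3) coercivity forces `d₀ (g - ψ) = 0`
  have h3 := hcoer (F.d₀ (fun y => g y - ψ y))
  rw [hQ0] at h3
  have hsq : ∑ x : Λ L M, ∑ i : Fin 3, (F.d₀ (fun y => g y - ψ y) x i) ^ 2 ≤ 0 := by
    by_contra hne
    have hpos : 0 < ∑ x : Λ L M, ∑ i : Fin 3, (F.d₀ (fun y => g y - ψ y) x i) ^ 2 := lt_of_not_ge hne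
    have := mul_pos (mul_pos two_pos hc₀) hpos
    linarith
  have hzero := hsc_eq_zero_of_sum_sum_sq_nonpos _ hsq
  -- (4) conclude
  funext x i
  rw [hσ' x i, hzero x i, add_zero, hσb i]

end Summit.HubbardSuperconductivity.HubbardSuperconductivity.Theorems.FSUnfolding
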